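import Literature.Analysis.FluidPDE.EnergySpaceRellich
import Literature.Analysis.FluidPDE.StatisticalSolutionProofs
import Literature.Analysis.FluidPDE.LerayProjector
import Summits.AnomalousDissipation.AnomalousDissipation.Theorems.TaylorCertificatesFloorCertificateStubSublevelCompact
import Mathlib.MeasureTheory.Measure.Prokhorov
import Mathlib.MeasureTheory.Measure.LevyProkhorovMetric
import Mathlib.MeasureTheory.Measure.Portmanteau
import Mathlib.MeasureTheory.Measure.SeparableMeasure
import HarnessLib

/-!
# Stub `stub_tightLimit` (S1) of the line `cutoff_compactness`
# (crux `TameRoughRigidity.TameClosure`, stmt-AnomalousDissipation-18402)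

TIGHT LIMIT IN THE TAME CLASS (pure measure theory on the energy space `H = L²_σ(T³)`, norm
topology, Borel σ-algebra). A sequence `μₙ` of Borel probability measures on `H` with integrable
energy, mean energy `∫ |v|² dμₙ ≤ E` and mean enstrophy `∫⁻ ‖∇v‖² dμₙ ≤ G₁` has a subsequence
converging against every bounded continuous observable `h : H → ℝ` to a Borel probability measure
`μ'` with integrable energy, mean energy `≤ E` and mean enstrophy `≤ G₁`.

Proof (Foias–Manley–Rosa–Temam 2001, Ch. IV §3.1 Prop. 3.1; Billingsley, Thm. 5.1).

* TIGHTNESS: Markov on the mean enstrophy, `μₙ{‖∇v‖² ≥ t} ≤ G₁ / t`, and Rellich — the enstrophy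
  balls `{‖∇v‖² ≤ t}`, `t < ∞`, are norm-compact in `H` (`Torus.isCompact_setOf_eGradNormSq_le`);
  packaged in the tree as
  `TaylorCertificatesFloorCertificate.isTightMeasureSet_of_lintegral_le_of_isCompact`.
* EXTRACTION: Prokhorov (Mathlib `isCompact_closure_of_isTightMeasureSet`) and the Lévy–Prokhorov
  metrisability of `ProbabilityMeasure H` (`H` is a separable metric space: a subspace of the
  second-countable `L²(T³; ℝ³)`, Mathlib `Lp.SecondCountableTopology`) give a weakly convergent
  subsequence (`IsCompact.tendsto_subseq`); weak convergence is convergence against bounded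
  continuous real observables (`ProbabilityMeasure.tendsto_iff_forall_integral_tendsto`).
* BOUNDS ON THE LIMIT: the open-set portmanteau inequality
  (`ProbabilityMeasure.le_liminf_measure_open_of_tendsto`) gives `∫ F dμ' ≤ liminf ∫ F dμ_{φ n}`
  for the continuous energy `F = |v|²`
  (`lintegral_le_liminf_lintegral_of_forall_isOpen_measure_le_liminf_measure`) and for the lower
  semicontinuous spectral enstrophy `F = ‖∇v‖² ∈ [0, ∞]`
  (`Torus.lowerSemicontinuous_eGradNormSq_coe`; truncations `‖∇v‖² ∧ n`, layer cake and Fatou: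
  `lintegral_le_liminf_lintegral_of_lowerSemicontinuous'`);
  finiteness of `∫⁻ |v|² dμ' ≤ E` is the integrability of the energy under `μ'`.

References: C. Foias, O. Manley, R. Rosa, R. Temam, *Navier–Stokes Equations and Turbulence*
(CUP 2001), Ch. IV §3.1 Prop. 3.1, Ch. II §6; P. Billingsley, *Convergence of Probability
Measures*, 2nd ed., Thm. 2.1 (portmanteau), Thm. 5.1 (Prokhorov).
-/

-- `Summit.<Summit>.<Problem>`: single-conjunct summit, the duplicate namespace segment is mandated.
set_option linter.dupNamespace false

noncomputable section

namespace Summit.AnomalousDissipation.AnomalousDissipation.Theorems.TameRoughRigidity.TameClosure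

open MeasureTheory Filter Topology UnitAddTorus
open scoped InnerProductSpace RealInnerProductSpace ENNReal NNReal
open Literature.Analysis.FunctionSpaces Literature.Analysis.FluidPDE

/-- Local notation: real vector fields on `T³`. -/
local notation "Vec3" => (UnitAddTorus (Fin 3)) → (EuclideanSpace ℝ (Fin 3))
/-- Local notation: `L²(T³; ℝ³)`. -/
local notation "L2" => (Lp (EuclideanSpace ℝ (Fin 3)) 2 (volume : Measure (UnitAddTorus (Fin 3))))
/-- Local notation: the energy space `H`. -/
local notation "H3" => (Torus.energySpace (Fin 3))

-- adapted from `…Theorems.MomentParityResolvedDissipation.TightExtraction.`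
--   `lintegral_le_liminf_lintegral_of_lowerSemicontinuous`
-- (Theorems/MomentParityResolvedDissipationStubTightExtraction.lean); kept private here to avoid
-- that file's import closure.
/-- **lsc portmanteau in `[0, ∞]`.** If every open set satisfies `μ U ≤ liminf μ_i U` (e.g.
`μ_i ⇀ μ` weakly, probability measures), then `∫⁻ G dμ ≤ liminf ∫⁻ G dμ_i` for every lower
semicontinuous `G : Ω → [0, ∞]`: for the truncation `g = (G ∧ n).toReal` (real, nonnegative,
with OPEN strict superlevel sets `{t < g} = {ofReal t < G} ∩ {ofReal t < n}`) the layer-cake formula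
`∫ g = ∫₀^∞ μ{t < g} dt`, the open-set inequality and Fatou in `t` give the claim for `G ∧ n`, and
monotone convergence lets `n → ∞` (Billingsley, *Convergence of Probability Measures*, Thm. 2.1 and
Problem 2.6; the argument of Mathlib's
`lintegral_le_liminf_lintegral_of_forall_isOpen_measure_le_liminf_measure` for continuous `g`). -/
private theorem lintegral_le_liminf_lintegral_of_lowerSemicontinuous' {Ω : Type*}
    [MeasurableSpace Ω] [TopologicalSpace Ω] [OpensMeasurableSpace Ω]
    {μ : Measure Ω} {μs : ℕ → Measure Ω} {G : Ω → ℝ≥0∞} (hG : LowerSemicontinuous G)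
    (h_opens : ∀ U, IsOpen U → μ U ≤ atTop.liminf (fun i => μs i U)) :
    ∫⁻ x, G x ∂μ ≤ atTop.liminf (fun i => ∫⁻ x, G x ∂(μs i)) := by
  have hGm : Measurable G := hG.measurable
  -- truncations at height `n`
  have key : ∀ n : ℕ, ∫⁻ x, G x ⊓ (n : ℝ≥0∞) ∂μ ≤ atTop.liminf (fun i => ∫⁻ x, G x ∂(μs i)) := by
    intro n
    have hne : ∀ x, G x ⊓ (n : ℝ≥0∞) ≠ ⊤ := fun x =>
      ne_top_of_le_ne_top (ENNReal.natCast_ne_top n) inf_le_right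
    set g : Ω → ℝ := fun x => (G x ⊓ (n : ℝ≥0∞)).toReal with hg_def
    have hg_eq : ∀ x, ENNReal.ofReal (g x) = G x ⊓ (n : ℝ≥0∞) := fun x =>
      ENNReal.ofReal_toReal (hne x)
    have g_nn : 0 ≤ g := fun x => ENNReal.toReal_nonneg
    have g_mble : Measurable g := (hGm.min measurable_const).ennreal_toReal
    have hopen : ∀ t : ℝ, IsOpen {a | t < g a} := by
      intro t
      by_cases ht : t < 0
      · convert isOpen_univ
        exact Set.eq_univ_of_forall fun a => ht.trans_le (g_nn a)
      · push Not at ht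
        have hset : {a | t < g a} =
            G ⁻¹' Set.Ioi (ENNReal.ofReal t) ∩ {_a | ENNReal.ofReal t < (n : ℝ≥0∞)} := by
          ext a
          simp only [Set.mem_setOf_eq, Set.mem_inter_iff, Set.mem_preimage, Set.mem_Ioi]
          rw [hg_def, ← ENNReal.ofReal_lt_iff_lt_toReal ht (hne a), lt_inf_iff]
        rw [hset]
        exact (hG.isOpen_preimage _).inter isOpen_const
    -- layer cake + Fatou in `t` for the truncation
    have hlc : ∫⁻ x, ENNReal.ofReal (g x) ∂μ ≤
        atTop.liminf (fun i => ∫⁻ x, ENNReal.ofReal (g x) ∂(μs i)) := by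
      simp_rw [lintegral_eq_lintegral_meas_lt _ (Eventually.of_forall g_nn) g_mble.aemeasurable]
      calc ∫⁻ (t : ℝ) in Set.Ioi 0, μ {a | t < g a}
          ≤ ∫⁻ (t : ℝ) in Set.Ioi 0, atTop.liminf (fun i => (μs i) {a | t < g a}) :=
            lintegral_mono fun t => h_opens _ (hopen t)
        _ ≤ atTop.liminf (fun i => ∫⁻ (t : ℝ) in Set.Ioi 0, (μs i) {a | t < g a}) :=
            lintegral_liminf_le fun i => Antitone.measurable fun s t hst =>
              measure_mono fun ω hω => lt_of_le_of_lt hst hω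
    calc ∫⁻ x, G x ⊓ (n : ℝ≥0∞) ∂μ = ∫⁻ x, ENNReal.ofReal (g x) ∂μ := by simp_rw [hg_eq]
      _ ≤ atTop.liminf (fun i => ∫⁻ x, ENNReal.ofReal (g x) ∂(μs i)) := hlc
      _ = atTop.liminf (fun i => ∫⁻ x, G x ⊓ (n : ℝ≥0∞) ∂(μs i)) := by simp_rw [hg_eq]
      _ ≤ atTop.liminf (fun i => ∫⁻ x, G x ∂(μs i)) :=
          liminf_le_liminf (Eventually.of_forall fun i => lintegral_mono fun x => inf_le_left)
  have hsup : ∀ x, ⨆ n : ℕ, G x ⊓ (n : ℝ≥0∞) = G x := fun x => by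
    rw [← inf_iSup_eq, ENNReal.iSup_natCast, inf_top_eq]
  calc ∫⁻ x, G x ∂μ = ∫⁻ x, ⨆ n : ℕ, G x ⊓ (n : ℝ≥0∞) ∂μ := by simp_rw [hsup]
    _ = ⨆ n : ℕ, ∫⁻ x, G x ⊓ (n : ℝ≥0∞) ∂μ :=
        lintegral_iSup (fun n => hGm.min measurable_const) fun m n hmn x =>
          inf_le_inf le_rfl (by exact_mod_cast hmn)
    _ ≤ atTop.liminf (fun i => ∫⁻ x, G x ∂(μs i)) := iSup_le key

/-- **Weak subsequential limits of probability laws on `H` with bounded mean enstrophy.** A sequence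
of Borel probability measures on `H = L²_σ(T³)` with mean enstrophy `≤ C < ∞` has a subsequence
converging weakly (in `ProbabilityMeasure H`) to a probability law: tight by Markov + Rellich
(`isTightMeasureSet_of_lintegral_le_of_isCompact`, `Torus.isCompact_setOf_eGradNormSq_le`),
relatively compact by Prokhorov (`isCompact_closure_of_isTightMeasureSet`), sequentially so because
`ProbabilityMeasure H` is pseudo-metrisable (Lévy–Prokhorov; `H` is separable).
FMRT 2001, Ch. IV §3.1 Prop. 3.1; Billingsley, Thm. 5.1. -/
theorem exists_subseq_tendsto_of_ensembleEnstrophy_le (P : ℕ → ProbabilityMeasure H3) {C : ℝ≥0∞}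
    (hC : C ≠ ∞) (hG : ∀ n, Torus.ensembleEnstrophy (P n : Measure H3) ≤ C) :
    ∃ φ : ℕ → ℕ, StrictMono φ ∧ ∃ Q : ProbabilityMeasure H3, Tendsto (P ∘ φ) atTop (𝓝 Q) := by
  haveI : Fact ((2 : ℝ≥0∞) ≠ ∞) := ⟨ENNReal.ofNat_ne_top⟩
  haveI : SecondCountableTopology L2 := inferInstance
  haveI : SecondCountableTopology H3 := TopologicalSpace.Subtype.secondCountableTopology _
  have htight : IsTightMeasureSet
      {((Q : ProbabilityMeasure H3) : Measure H3) | Q ∈ Set.range P} := by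
    refine TaylorCertificatesFloorCertificate.isTightMeasureSet_of_lintegral_le_of_isCompact
      (Torus.measurable_eGradNormSq_coe (d := Fin 3))
      (fun R hR => Torus.isCompact_setOf_eGradNormSq_le hR) hC ?_
    rintro _ ⟨Q, ⟨n, rfl⟩, rfl⟩
    exact hG n
  obtain ⟨Q, -, φ, hφ, hQ⟩ := (isCompact_closure_of_isTightMeasureSet htight).tendsto_subseq
    (x := P) fun n => subset_closure (Set.mem_range_self n)
  exact ⟨φ, hφ, Q, hQ⟩

/-- **S1 `stub_tightLimit`** — TIGHT LIMIT IN THE TAME CLASS. A sequence of Borel probability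
measures on `H` with integrable energy, mean energy `≤ E` and mean enstrophy `≤ G₁` has a
subsequence that converges against every bounded continuous observable to a Borel probability
measure with integrable energy, mean energy `≤ E` and mean enstrophy `≤ G₁`: extraction by
`exists_subseq_tendsto_of_ensembleEnstrophy_le` (Markov + Rellich + Prokhorov + Lévy–Prokhorov),
identification of the limit against bounded continuous observables
(`ProbabilityMeasure.tendsto_iff_forall_integral_tendsto`), and the two bounds by the open-set
portmanteau inequality applied to the continuous energy `|v|²`
(`lintegral_le_liminf_lintegral_of_forall_isOpen_measure_le_liminf_measure`) and to the lower
semicontinuous spectral enstrophy (`Torus.lowerSemicontinuous_eGradNormSq_coe`,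
`lintegral_le_liminf_lintegral_of_lowerSemicontinuous'`). FMRT 2001, Ch. IV §3.1 Prop. 3.1;
Billingsley, Thms. 2.1, 5.1. -/
theorem stub_tightLimit (E G₁ : ℝ) (μ : ℕ → Measure H3)
    (hprob : ∀ n, IsProbabilityMeasure (μ n))
    (hint : ∀ n, Integrable (fun v : H3 => ‖v‖ ^ 2) (μ n))
    (hE : ∀ n, Torus.ensembleEnergy (μ n) ≤ E)
    (hG : ∀ n, Torus.ensembleEnstrophy (μ n) ≤ ENNReal.ofReal G₁) :
    ∃ φ : ℕ → ℕ, StrictMono φ ∧ ∃ μ' : Measure H3, IsProbabilityMeasure μ' ∧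
      Integrable (fun v : H3 => ‖v‖ ^ 2) μ' ∧ Torus.ensembleEnergy μ' ≤ E ∧
      Torus.ensembleEnstrophy μ' ≤ ENNReal.ofReal G₁ ∧
      ∀ h : H3 → ℝ, Continuous h → (∃ C : ℝ, ∀ v, |h v| ≤ C) →
        Tendsto (fun n => ∫ v, h v ∂(μ (φ n))) atTop (𝓝 (∫ v, h v ∂μ')) := by
  -- the laws as probability measures, and the extraction
  let P : ℕ → ProbabilityMeasure H3 := fun n => ⟨μ n, hprob n⟩
  obtain ⟨φ, hφ, Q, hQ⟩ :=
    exists_subseq_tendsto_of_ensembleEnstrophy_le P ENNReal.ofReal_ne_top fun n => hG n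
  -- portmanteau: open sets
  have hopen : ∀ U : Set H3, IsOpen U →
      (Q : Measure H3) U ≤ atTop.liminf (fun i => μ (φ i) U) :=
    fun U hU => ProbabilityMeasure.le_liminf_measure_open_of_tendsto hQ hU
  -- bounded continuous observables
  have hBC : ∀ h : H3 → ℝ, Continuous h → (∃ C : ℝ, ∀ v, |h v| ≤ C) →
      Tendsto (fun n => ∫ v, h v ∂(μ (φ n))) atTop (𝓝 (∫ v, h v ∂(Q : Measure H3))) := by
    rintro h hh ⟨C, hC⟩
    exact (ProbabilityMeasure.tendsto_iff_forall_integral_tendsto.1 hQ)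
      (BoundedContinuousFunction.ofNormedAddCommGroup h hh C fun v => by
        rw [Real.norm_eq_abs]; exact hC v)
  -- energy of the limit: `∫⁻ |v|² dQ ≤ liminf ∫⁻ |v|² dμ_{φ i} ≤ E`
  have hEn : ∫⁻ v, ENNReal.ofReal (‖v‖ ^ 2) ∂(Q : Measure H3) ≤ ENNReal.ofReal E := by
    refine (lintegral_le_liminf_lintegral_of_forall_isOpen_measure_le_liminf_measure
      (μ := (Q : Measure H3)) (μs := fun i => μ (φ i)) (f := fun v : H3 => ‖v‖ ^ 2)
      (by fun_prop) (fun v => sq_nonneg _) hopen).trans ?_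
    refine liminf_le_of_frequently_le' (Frequently.of_forall fun i => ?_)
    rw [← ofReal_integral_eq_lintegral_ofReal (hint (φ i))
      (Eventually.of_forall fun v => sq_nonneg _)]
    exact ENNReal.ofReal_le_ofReal (hE (φ i))
  have hInt : Integrable (fun v : H3 => ‖v‖ ^ 2) (Q : Measure H3) :=
    (lintegral_ofReal_ne_top_iff_integrable (by fun_prop)
      (Eventually.of_forall fun v => sq_nonneg _)).1 (hEn.trans_lt ENNReal.ofReal_lt_top).ne
  have hE' : Torus.ensembleEnergy (Q : Measure H3) ≤ E := by
    have hE0 : 0 ≤ E := (integral_nonneg fun v => sq_nonneg _).trans (hE 0)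
    rw [Torus.ensembleEnergy, ← ENNReal.ofReal_le_ofReal_iff hE0,
      ofReal_integral_eq_lintegral_ofReal hInt (Eventually.of_forall fun v => sq_nonneg _)]
    exact hEn
  -- enstrophy of the limit: lsc portmanteau
  have hG' : Torus.ensembleEnstrophy (Q : Measure H3) ≤ ENNReal.ofReal G₁ := by
    refine (lintegral_le_liminf_lintegral_of_lowerSemicontinuous'
      (μs := fun i => μ (φ i)) Torus.lowerSemicontinuous_eGradNormSq_coe hopen).trans ?_
    exact liminf_le_of_frequently_le' (Frequently.of_forall fun i => hG (φ i))
  exact ⟨φ, hφ, Q, inferInstance, hInt, hE', hG', hBC⟩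

end Summit.AnomalousDissipation.AnomalousDissipation.Theorems.TameRoughRigidity.TameClosure

end
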